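import Summits.BirchSwinnertonDyer.Rank1Residual.Additive.X4RankZeroKatoBoundSharp
import Summits.BirchSwinnertonDyer.Rank1Residual.Additive.QuadraticTwistBSDComparisonIsogeny
import Summits.BirchSwinnertonDyer.Rank1Residual.Additive.PotSupersingularClasses
import HarnessLib

/-!
# O6 (WILD `p = 3`), REDUCIBLE image: the torsion-free Kato bound R₀• for the X3-wild rank-0 cell (target T-O6-X3R),
# the zeta-integrality conjecture (I-X3•), the bound R♮ as a HYPOTHESIS SHAPE, and the Cassels class transport
(cell `b2b-bsdres`, lane CLASS-CLOSURE, class O6 §3.4 ∩ X3; planner o6-r1 GEN 20 — memo `HOME/b2b-bsdres-o6-r1/gen20/O6-GEN20.md`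
 (sha16 `d68828bc84206259`) §1 THEOREM-CANDIDATE R♮, §2.1 (I-X3•), §2.2 R₀• with its Lean shape and the CLASS TRANSPORT, §2.3 reach,
 §4 census C-O6-RED; TARGETS §O6 (G20-1)–(G20-4); INBOX 2026-08-22T06:55Z l.10164, docketed to this seat by cc-lead GEN 52 as (c18);
 typer of record cc-typer-5 GEN 14; 0 Literature facts.)

HONEST FRAMING (cell `b2b-bsdres`, run/shared/lean/b2b/bsd-rank1-residual/, verbatim in every file): the goal of the cell is
to DELETE the COMBINATION-SHAPED residual classes of the Birch–Swinnerton-Dyer formula for ALL analytic-rank `≤ 1` elliptic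
curves over `ℚ` — "full BSD formula for every rank `≤ 1` curve in class `C`" assembled STRICTLY from published theorems — so that
the rank-`≤ 1` remainder becomes exactly the CONSTRUCTION-SHAPED classes, which are TYPED (missing-input `Prop`s), NOT attempted.
This is not "finishing BSD". Lane CLASS-CLOSURE: research routes; census output is EVIDENCE / conjecture items, never a Literature
fact; no main conjecture inside any certificate; nothing is booked; no mark of `RESIDUAL-MAP.md` moves; O6 and X3 stay OPEN.

SETTING (memo §1–§2). `W/ℚ` globally minimal, WILD additive (hence potentially good) at `3` — `ClassO6 W 3` (`v₃(N) ≥ 3`) — with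
REDUCIBLE `W[3]` (a rational `3`-isogeny; the X3 half: `¬ W.HasIrreducibleModPGaloisRep 3`), `L(W,1) ≠ 0`.  Kato's Thm 14.5 (3)
needs (12.5.2) (image ⊇ `SL₂(ℤ₃)`), which FAILS here; the tree's A161″
`Kato2004.rankZero_padicValNat_sha_add_padicValNat_tamagawa_le_of_additive_potGood_of_imageContainsSL2` (lit-kato, p320328) is the
big-image twin.  o6-r1's THEOREM-CANDIDATE **R♮** (memo §1, image-free: Kato 12.5 (3) at every height-one `𝔮 ∌ p` incl. the
augmentation prime, the descent sequences (14.14.1–2), Lemma 14.15, `μ(𝐇²(T)) = 0` from Wuthrich 2014 Lemma 14 (a `3`-isogeny ⇒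
`Y` finitely generated over `ℤ₃`), a Herbrand step replacing freeness, and the level-`0` bookkeeping of THEOREM T):
**`ord₃ #Ш(W)[3^∞] ≤ ord₃ #Ш_an(W) + t_W − e_W`** for every member `W` of the class, `t_W = ord₃ #W(ℚ)_tors`, `e_W ∈ ℤ` = the
`3`-adic INTEGRALITY EXPONENT of Kato's zeta element at the reflexive hull of `𝐇¹(T₃W)⁺` (`λ_W = 3^{e_W}·λ♭`).  R♮ is lit-kato's
AUDIT object (AUD-1…AUD-8, memo §1) — AUDIT DONE by lit-kato GEN 26 (`HOME/b2b-bsdres-lit-kato/gen26/KATO-PAGE-READ-gen26.md` §B,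
INBOX 2026-08-22T07:24Z): AUD-1/2/3/6/7/8 PASS on the held pages (12.5 (3) p. 222 image-free at `𝔮 ∌ p`, CM via Prop 15.17 under Rubin
15.2 (a); the generalised index pp. 236–237 tolerates torsion and non-integral `z`; Wuthrich L14 p. 396 reduction-free; (14.14.1–2)
p. 243 image-free; 14.16 (2) p. 244 any lattice), AUD-4 SOUND by the ten-line derivation D-AUD4 (Poitou–Tate + local duality,
`μ(𝐇²_S) = μ(Y)` per `Δ`-component, the `j_*` correction named, Imai not needed), wording fixes (w1)(w2) to the memo — "R♮ STANDS as a
composite of printed theorems + D-AUD4"; `e_W` has no tree vocabulary (XL), so lit-kato types nothing.  Per cc-lead GEN 52/53 R♮ is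
NOT typed as a fact, a theorem or a node here, only as the displayed HYPOTHESIS SHAPE `KatoReducibleShaBoundShapeThree realE` (§2).

WHAT IS TYPED.
* §1 interface **D-O6-ZE**: the integrality exponent `e_W` has no tree vocabulary (no Iwasawa cohomology `𝐇¹(T)`, no zeta
  element `z_γ`); it is read under a realisation predicate `realE W e` (a section variable, bound as `realP`/`realT` are:
  "`e` IS `e_W` at `p = 3`"; `fun _ _ => True/False` are not legitimate bindings).
* §2 **`KatoReducibleShaBoundShapeThree realE`** — R♮ at `p = 3` in the A161″ currency: for `W` additive potentially good at
  `3` with reducible `W[3]`, `L(W,1) ≠ 0`, `Ш` finite, and `realE W e`: `L(W,1)/Ω_W = q ∈ ℚ` and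
  `ord₃ #Ш[3^∞] + v₃(∏ c_ℓ) + e ≤ ord₃ q + 3·ord₃ #W(ℚ)_tors` (= R♮ with `ord₃ #Ш_an = ord₃ q + 2 t_W − v₃(∏ c_ℓ)`).  A plain
  `def`, used only as `(h : …)`.
* §3 **`@[conjecture] ZetaIntegralityTorsionFreeThree realE`** = CONJECTURE (I-X3•) (memo §2.1): on every X3 ∧ O6 ∧ `r_an = 0`
  member WITHOUT rational `3`-torsion, `e_W ≥ 0` (the additive twin of Wuthrich 2014 Thm 2 / Thm 13, which is GOOD-reduction-only —
  print: Thm 2 pp. 382–383, Thm 13 p. 395, lit-kato GEN 29 W-1; no Coleman map / Kato 17.11 at an additive prime).  EVIDENCE = its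
  computable finite-level shadow (memo §3.1–3.1′: `e_W < 0 ⇒ minv(W,n) < 0` for `n ≫ 0`), census C-O6-RED.  **RETIRED as a line of
  attack by o6-r1 GEN 21** (the decl and its `@[conjecture]` tag stay until a kernel proof or kill): Kato Thm 12.6 + 13.14 s.1–2 give
  `e ≥ 0` at KATO'S MEMBER `W_K` (T-X3K, `O6/X3KatoMemberBound.lean`, lit-kato AUD-9 PASS), which C-X3K-2 finds to be the member WITH
  `3`-torsion in 135/273 non-generic classes `N ≤ 10⁴`; parity (T-X3K♯) makes the vertex irrelevant for the bound.
* §4 **`@[conjecture] X3WildTorsionFreeKatoBoundThree`** = the TARGET **R₀• = R♮ ∧ (I-X3•)** (memo §2.2): A161″'s statement with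
  `Kato2004.ImageContainsSL2 W p` REPLACED by `¬ W.HasIrreducibleModPGaloisRep 3 ∧ ¬ 3 ∣ #W(ℚ)_tors`, conclusion VERBATIM
  (`∃ q, L(W,1)/Ω_W = q ∧ ord₃ #Ш[3^∞] + v₃(∏ c_ℓ) ≤ ord₃ q`).  A closed node (no interface), the consumer's END hypothesis.
* §5 PROVED bookkeeping: `x3WildTorsionFreeKatoBoundThree_of_shape_of_integrality` (R♮-shape ∧ (I-X3•) ∧ "`e_W` is realised" ⟹
  R₀•: `t_W = 0`, `e ≥ 0`, linear arithmetic), **`X3WildRankZero.missingUpperBoundAt_of_torsionFreeKatoBound`** (R₀• ⟹ the typed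
  UPPER half `MissingUpperBoundAt W 3` at the torsion-free member, Miller currency — the `X4RankZeroKatoBoundSharp` conversion with
  `ord₃ #tors = 0`), and the **CLASS TRANSPORT `X3WildRankZero.missingUpperBoundAt_of_isIsogenous_torsionFree`**: R₀• at a
  torsion-free member `E•` ⟹ `MissingUpperBoundAt W′ 3` for EVERY `ℚ`-isogenous `W′` (Cassels: `#Ш_an/#Ш` is class-constant —
  the tree's `Additive.TwistComparison.missingUpperBoundAt_of_isIsogenous`, REUSED by name, over the named fact
  `WeierstrassCurve.bsdRHS_eq_of_isIsogenous`).
NOT typed (recorded): the EXISTENCE of a torsion-free member `E•` in every X3 class at `3` (memo §2.2: walk the `3`-isogeny path;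
Mazur–Kenku bounds cyclic `3^k`-isogenies by `k ≤ 3`; data 9 476/9 476) — no kernel route (Mazur's isogeny theorem is not in the
tree); consumers display the member.  The p ≠ 3 / TAME analogues of R₀• are NOT typed: (I-X3•) is conjectured on X3 ∧ O6 only
(TYPER DECISION: the memo's Lean shape quantified every odd additive potentially good `p`; the class binder `ClassO6 W 3` matches
the conjecture's and the census's population — `ClassO6.addv` / `ClassO6.padicValRat_j_nonneg` recover A161″'s four binders).
FIRST REFUSAL (cc-lead GEN 52): n1011-p04's A161″ consumers (`X4RankZero.…_of_katoTam`) need `ImageContainsSL2` and do not cover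
this reducible cell — no supersession; if n1011 / o6-r2 claim it, this file is the shared statement, not a second one.
DEDUP (`lean search` / grep): `X3WildTorsionFree`, `ZetaIntegralityTorsionFree`, `KatoReducibleShaBoundShape` — no match;
reused by name: `MissingUpperBoundAt`, `shaAn`, `bsdRHS_eq_of_isIsogenous`, `TwistComparison.missingUpperBoundAt_of_isIsogenous`,
`ClassO6`, `Addv`, `IsIsogenous`, `rank_eq_analyticRank_of_analyticRank_le_one`, `hasEntireLFunction_rat`.

EVIDENCE of record (census cell O6, o6-r1 GEN 20; pre-registration `gen20/red/RED-PREREG.md` sha16 `2fce4e10bc60ac81` written BEFORE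
the runs + ADDENDUM A; instrument gen-18 `c_o6_lam.py` v1.2 unchanged; kit j153807 CORE = all 459 members of the 211 X3∧O6∧r0
classes with `N ≤ 6075`, j153812 EXT held-out `6075 < N ≤ 10⁴` running at typing time): **P-RED-2 211/211** — in every class the
torsion-free vertex has `minv ≥ 0` at `n = 0, 1, 2`; in fact EVERY torsion-free member of CORE is INT (27/27 generic-class members +
201/201 non-generic `E•`) and `minv < 0` occurs ONLY at vertices with rational `3`-torsion (16 NONINT, 67 UNDEC, 148 INT of 231);
P-RED-1 211/0/0; P-RED-3 192/192 on its clean cell; P-RED-5 1262/1262; P-RED-6 744/744; P-RED-4 FAILED AS REGISTERED (scope error,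
disclosed; 192/192 on its home cell); C-X3R-1 (Sel³-excess falsifier of R₀• on 13 exact r0 X3 3-descents incl. wild 4914n2, 7182j2,
CM 27a1/27a3): 0 violations; REACH (§0/§2.3): every one of the 9 476 X3-wild r0 classes has a member with `3 ∤ #tors`; 8 410 have one
with `t = 0 ∧ 3 ∤ #Ш_an` (closed outright by R₀• + transport), the other 1 066 need a LOWER-bound certificate at `E•` besides.
PRESEARCH (planner, memo §1 end; typer re-ran the galaxy needle 2026-08-22): R♮ / (I-X3•) not in print — nearest Wuthrich 2014
Thm 13 (good reduction at `p` only, p. 395; p. 383 "cannot be extended to primes of additive reduction"), Castella–Grossi–Lee–Skinner (Eisenstein,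
good ordinary), tree A161″ (X4).  References: K. Kato, Astérisque 295 (2004) Thm. 12.5 (3), (14.14.1–2), Lemma 14.15, Thm. 14.5 (3),
Prop. 14.16 (2) [Kato2004Asterisque]; C. Wuthrich, Doc. Math. 19 (2014) Lemma 14, Thm. 13, Thm. 16 [Wuthrich2014]; R. Greenberg,
LNM 1716 Prop. 4.13 [GreenbergLNM1716]; J. W. S. Cassels, J. reine angew. Math. 217 (1965) [Cassels1965ArithmeticVIII]; J. S. Milne,
ADT Thm. I.7.3 [MilneADT2006]; R. L. Miller, LMS J. Comput. Math. 14 (2011) Def. 1.1 [Miller2011LMS].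
-/

set_option autoImplicit false

noncomputable section

open scoped Classical

open WeierstrassCurve Literature.NumberTheory.EllipticCurves
  Literature.NumberTheory.EllipticCurves.ModularForms
  Literature.NumberTheory.EllipticCurves.Rank1Residual
  Literature.NumberTheory.EllipticCurves.Rank1Residual.Typed
  Summit.BirchSwinnertonDyer.Rank1Residual.Additive

namespace Summit.BirchSwinnertonDyer.Rank1Residual.O6

section Interface

/-! ## §1 D-O6-ZE — the integrality exponent `e_W` of Kato's zeta element (INTERFACE) -/

variable (realE : ∀ (W : WeierstrassCurve ℚ) [W.IsElliptic] [W.IsGloballyMinimal], ℤ → Prop)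

/-! ## §2 R♮ at `p = 3` as a HYPOTHESIS SHAPE (lit-kato's audit object; NOT a node, NOT a fact) -/

/-- **R♮ (o6-r1 GEN 20 §1) at `p = 3`, as a HYPOTHESIS SHAPE over D-O6-ZE.**  For `W/ℚ` globally minimal, additive and
potentially good at `3` (`Addv W 3`, `0 ≤ v₃(j)`), with REDUCIBLE `W[3]` (a rational `3`-isogeny), `L(W,1) ≠ 0`, `Ш(W)` finite,
and `e = e_W` realised: `L(W,1)/Ω_W` is a rational `q` and **`ord₃ #Ш(W)[3^∞] + v₃(∏_ℓ c_ℓ(W)) + e_W ≤ ord₃ q + 3·ord₃ #W(ℚ)_tors`**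
— the memo's `ord₃ #Ш[3^∞] ≤ ord₃ #Ш_an + t_W − e_W` with `#Ш_an = q·#tors²/∏ c_ℓ` written out.  INTENDED BINDING of `realE`:
"`e` IS the `3`-adic integrality exponent of Kato's zeta element `z_γ` at the reflexive hull of `𝐇¹(T₃W)⁺`, `λ_W = 3^{e}·λ♭`
(memo §1)" — no tree vocabulary; `fun _ _ => True` / `False` are NOT legitimate bindings.  THEOREM-CANDIDATE, AUDITED (lit-kato
GEN 26 `KATO-PAGE-READ-gen26.md` §B: AUD-1/2/3/6/7/8 PASS on the pages, AUD-4 SOUND by derivation D-AUD4 — Kato 12.5 (3) image-free at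
`𝔮 ∌ p`; (14.14.1–2) image-free; Lemma 14.15; `μ = 0` via Wuthrich L14; the Herbrand step; 14.16 (2) at `r = 1`) — used ONLY as
`(h : KatoReducibleShaBoundShapeThree realE)`; nothing asserted; not a Literature fact (D-0026: `e_W` untyped). Plain `def`.
[cite: Kato2004Asterisque, Thm. 12.5 (3) (p. 222), (14.14.1)–(14.14.2) (p. 243), Lemma 14.15 (pp. 243–244), Prop. 14.16 (2) (p. 244)]
[cite: Wuthrich2014, Lemma 14 (p. 396)] [cite: GreenbergLNM1716, Prop. 4.13] -/
def KatoReducibleShaBoundShapeThree : Prop :=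
  ∀ (W : WeierstrassCurve ℚ) [W.IsElliptic] [W.IsGloballyMinimal],
    Addv W 3 → 0 ≤ padicValRat 3 W.j → ¬ W.HasIrreducibleModPGaloisRep 3 →
    W.entireLFunction 1 ≠ 0 → Finite W.sha → ∀ e : ℤ, realE W e →
      ∃ q : ℚ, W.entireLFunction 1 / (W.realPeriodRat : ℂ) = (q : ℂ) ∧
        (padicValNat 3 (Nat.card (AddCommGroup.primaryComponent W.sha 3)) : ℤ) +
            padicValNat 3 W.tamagawaProduct + e ≤ padicValRat 3 q + 3 * (padicValNat 3 W.torsionOrder : ℤ)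

/-! ## §3 CONJECTURE (I-X3•) — zeta-integrality at the torsion-free members (EVIDENCE-labelled node) -/

/-- **(I-X3•) `ZetaIntegralityTorsionFreeThree` (o6-r1 GEN 20 §2.1; GENUINE CONJECTURE, EVIDENCE-labelled).**  For every
`W ∈ X3 ∧ O6` (`ClassO6 W 3`: wild additive, potentially good at `3`; `W[3]` reducible) with `L(W,1) ≠ 0` and NO rational
`3`-torsion (`3 ∤ #W(ℚ)_tors`): the integrality exponent is non-negative, `e_W ≥ 0` (hence `= 0` by memo §1 (8) if BSD₃ holds)
— the additive-potentially-good twin of Wuthrich 2014 Thm 2 / Thm 13 (`z_γ ∈ 𝐇¹(T_pE•)` at a prime `p` of GOOD reduction —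
print: Thm 2 pp. 382–383, Thm 13 p. 395, lit-kato GEN 29 W-1 — via the Coleman map and `ord(1 − α⁻¹) = 1`, both unavailable at an
additive `p`); weaker than "`z_γ ∈ 𝐇¹(T)`" (a finite hull defect is tolerated).  STATUS (o6-r1 GEN 21, INBOX 2026-08-22T09:00Z):
RETIRED as a line of attack — superseded by T-X3K (`O6/X3KatoMemberBound.lean`: Kato Thm 12.6 + 13.14 sentences 1–2 give `e ≥ 0`
at Kato's member `W_K`, lit-kato AUD-9 PASS; C-X3K-2: `W_K` is the member WITH `3`-torsion in 135/273 non-generic classes, so this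
decl bet on the wrong vertex half the time; parity makes the vertex irrelevant for the bound); the `@[conjecture]` ATTRIBUTE STAYS
(no kernel proof, no registered kill: P-RED-2 211/211 CORE + 102/102 EXT).
It is the ONLY non-printed input of the target R₀• (§4).  Why it might fail: a torsion-free member whose zeta element is
genuinely non-integral; its finite-level SHADOW is computable (memo §3.1–3.1′): `e_W < 0 ⇒ minv(W,n) < 0` for all large `n`
(`minv ≥ 0 ⟺` the integrality defect of `z_n` is a class of Kato's finite `S(W[3^∞]/k_n)`), so ONE class all of whose
torsion-free members show `minv < 0` with non-increasing defect at `n = 0, 1, 2` (registered P-RED-2 failure) is evidence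
against it (escape: a finite hull gap only).
[evidence: census cell O6, o6-r1 GEN 20 C-O6-RED (prereg gen20/red/RED-PREREG.md 2fce4e10bc60ac81 + ADDENDUM A before the data; instrument c_o6_lam.py v1.2 unchanged; kit j153807 CORE = 459 members / 211 classes, N ≤ 6075): P-RED-2 211/211 — every class's torsion-free vertex has minv ≥ 0 at n = 0,1,2; every torsion-free CORE member INT (27/27 generic + 201/201 E•); minv < 0 only at rational-3-torsion vertices (16 NONINT / 67 UNDEC / 148 INT of 231); EXT held-out j153812 (218 members, 6075 < N ≤ 10⁴) running at typing time — memo gen20/O6-GEN20.md d68828bc84206259 §4.2]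
[cite: Wuthrich2014, Thm. 13 (p. 395) and Lemma 14 (p. 396)] [cite: Kato2004Asterisque, Thm. 12.4 (2) and Thm. 12.5 (pp. 221–222)] -/
@[conjecture] def ZetaIntegralityTorsionFreeThree : Prop :=
  ∀ (W : WeierstrassCurve ℚ) [W.IsElliptic] [W.IsGloballyMinimal],
    ClassO6 W 3 → ¬ W.HasIrreducibleModPGaloisRep 3 → W.entireLFunction 1 ≠ 0 → ¬ (3 ∣ W.torsionOrder) →
      ∀ e : ℤ, realE W e → 0 ≤ e

end Interface

/-! ## §4 The TARGET R₀• — the torsion-free Kato bound on X3 ∧ O6 ∧ `r_an = 0` (closed node; the consumer's END hypothesis) -/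

/-- **R₀• `X3WildTorsionFreeKatoBoundThree` (o6-r1 GEN 20 §2.2, target T-O6-X3R; CONJECTURE = R♮ ∧ (I-X3•); EVIDENCE-labelled).**
For `W/ℚ` globally minimal in `ClassO6 W 3` (wild additive, potentially good at `3`) with `W[3]` REDUCIBLE
(`¬ W.HasIrreducibleModPGaloisRep 3`), NO rational `3`-torsion (`3 ∤ #W(ℚ)_tors`), `L(W,1) ≠ 0` and `Ш(W)` finite:
`L(W,1)/Ω_W` is a rational number `q` with **`ord₃ #Ш(W)[3^∞] + v₃(∏_ℓ c_ℓ(W)) ≤ ord₃ q`** — EXACTLY the tree's A161″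
`Kato2004.rankZero_padicValNat_sha_add_padicValNat_tamagawa_le_of_additive_potGood_of_imageContainsSL2` with the binder
`Kato2004.ImageContainsSL2 W p` replaced by "reducible ∧ torsion-free" (and `p = 3`, `ClassO6`: TYPER DECISION, module docstring —
the memo's shape ranged over every odd additive potentially good `p`; `ClassO6.addv` / `ClassO6.padicValRat_j_nonneg` give A161″'s
`p ≠ 2`, `¬good`, `¬mult`, `0 ≤ v₃(j)`).  Why it might fail: only through R♮'s audit items or (I-X3•); C-X3R-1 (exact 3-descents on
13 r0 X3 rows, wild 4914n2 / 7182j2 and CM 27a1 / 27a3 included): 0 violations.  REACH (EVIDENCE, memo §0/§2.3): with the class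
transport of §5 it closes BSD₃'s UPPER half for every member of all 9 476 X3-wild r0 classes and BSD₃ outright on the 8 410 classes
having a member with `t = 0 ∧ 3 ∤ #Ш_an`.  `_holds` route: R♮ audited + (I-X3•) (`x3WildTorsionFreeKatoBoundThree_of_shape_of_integrality`).
[evidence: census cell O6, o6-r1 GEN 20: C-X3R-1 0/13 violations; C-O6-RED P-RED-2 211/211 (as under ZetaIntegralityTorsionFreeThree); reach tables §0 (9 476 / 8 410 / 1 066) from pairs.tsv + Cremona ecdata, script gen20/red/build_red_pop.py]
[cite: Kato2004Asterisque, Thm. 14.5 (3) (p. 236) and Prop. 14.16 (2) (p. 244) — the big-image statement being replaced]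
[cite: Wuthrich2014, Thm. 13 (p. 395) and Lemma 14 (p. 396)] -/
@[conjecture] def X3WildTorsionFreeKatoBoundThree : Prop :=
  ∀ (W : WeierstrassCurve ℚ) [W.IsElliptic] [W.IsGloballyMinimal],
    ClassO6 W 3 → ¬ W.HasIrreducibleModPGaloisRep 3 → ¬ (3 ∣ W.torsionOrder) →
    W.entireLFunction 1 ≠ 0 → Finite W.sha →
      ∃ q : ℚ, W.entireLFunction 1 / (W.realPeriodRat : ℂ) = (q : ℂ) ∧
        (padicValNat 3 (Nat.card (AddCommGroup.primaryComponent W.sha 3)) : ℤ) +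
            padicValNat 3 W.tamagawaProduct ≤ padicValRat 3 q

/-! ## §5 PROVED bookkeeping: R♮ ∧ (I-X3•) ⟹ R₀•; R₀• ⟹ the typed upper half; the Cassels class transport -/

section Assembly

variable {realE : ∀ (W : WeierstrassCurve ℚ) [W.IsElliptic] [W.IsGloballyMinimal], ℤ → Prop}

/-- **R₀• = R♮ ∧ (I-X3•) (PROVED assembly over the shapes as hypotheses).**  Given the R♮-shape, the integrality conjecture and a
realisation of `e_W` on the cell (`hex`, the construction half of D-O6-ZE): at a torsion-free member `ord₃ #W(ℚ)_tors = 0` and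
`e_W ≥ 0`, so R♮'s inequality is R₀•'s.  Nothing is asserted about either hypothesis. [folklore] -/
theorem x3WildTorsionFreeKatoBoundThree_of_shape_of_integrality (hR : KatoReducibleShaBoundShapeThree realE)
    (hI : ZetaIntegralityTorsionFreeThree realE)
    (hex : ∀ (W : WeierstrassCurve ℚ) [W.IsElliptic] [W.IsGloballyMinimal],
      ClassO6 W 3 → ¬ W.HasIrreducibleModPGaloisRep 3 → ∃ e : ℤ, realE W e) :
    X3WildTorsionFreeKatoBoundThree := by
  intro W _ _ hO hred htors hL hfin
  obtain ⟨e, he⟩ := hex W hO hred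
  obtain ⟨q, hq, hle⟩ := hR W hO.2.1 (ClassO6.padicValRat_j_nonneg hO) hred hL hfin e he
  have h0 : 0 ≤ e := hI W hO hred hL htors e he
  have ht : padicValNat 3 W.torsionOrder = 0 := padicValNat.eq_zero_of_not_dvd htors
  refine ⟨q, hq, ?_⟩
  rw [ht, Nat.cast_zero, mul_zero, add_zero] at hle
  linarith

/-- **R₀• ⟹ the typed UPPER half `MissingUpperBoundAt W 3` at a torsion-free reducible O6 member of analytic rank `0`** (Miller's
currency `#Ш_an = q'`, `ord₃ #Ш ≤ ord₃ q'`): `#Ш_an = (L(W,1)/Ω_W)·#tors²/∏ c_ℓ` (`shaAn_def`, rank `0`: `Reg = 1`,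
`leadingLCoeff = L(W,1)`), `ord₃ #tors = 0`, so `ord₃ #Ш_an = ord₃ q − v₃(∏ c_ℓ)` and R₀• reads `ord₃ #Ш ≤ ord₃ #Ш_an`.  Granted GZK
(`hGZK`: `Ш` finite, `rank = 0`) and modularity (`hmod`: `L(W,1) ≠ 0 ⟺ r_an = 0`); the node is the displayed hypothesis `h`.
[cite: Miller2011LMS, Def. 1.1 (arXiv:1010.2431 p. 3)] [cite: Darmon2004, Thm. 3.22] -/
theorem X3WildRankZero.missingUpperBoundAt_of_torsionFreeKatoBound (h : X3WildTorsionFreeKatoBoundThree)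
    (hGZK : rank_eq_analyticRank_of_analyticRank_le_one) (hmod : hasEntireLFunction_rat)
    (W : WeierstrassCurve ℚ) [W.IsElliptic] [W.IsGloballyMinimal]
    (hO : ClassO6 W 3) (hred : ¬ W.HasIrreducibleModPGaloisRep 3) (htors : ¬ (3 ∣ W.torsionOrder))
    (hr : W.analyticRank = 0) : MissingUpperBoundAt W 3 := by
  have hL : W.entireLFunction 1 ≠ 0 := (W.analyticRank_eq_zero_iff_holds (hmod W)).mp hr
  obtain ⟨hmw, hfin⟩ := hGZK W (by rw [hr]; exact zero_le_one)
  haveI : Finite W.sha := hfin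
  have hmw0 : W.mordellWeilRank = 0 := by rw [hmw, hr]
  obtain ⟨q₀, hq₀, hle⟩ := h W hO hred htors hL hfin
  have hΩ : (W.realPeriodRat : ℂ) ≠ 0 := by exact_mod_cast W.realPeriodRat_pos_holds.ne'
  have hc0 : 0 < W.tamagawaProduct := W.tamagawaProduct_pos_holds
  have ht0 : 0 < W.torsionOrder := W.torsionOrder_pos_holds
  have hq₀0 : q₀ ≠ 0 := by
    rintro rfl
    rw [Rat.cast_zero, div_eq_zero_iff] at hq₀
    exact hq₀.elim hL hΩ
  refine ⟨q₀ * (W.torsionOrder : ℚ) ^ 2 / (W.tamagawaProduct : ℚ), ?_, ?_⟩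
  · have hLq : W.entireLFunction 1 = (q₀ : ℂ) * (W.realPeriodRat : ℂ) := by
      rw [← hq₀, div_mul_cancel₀ _ hΩ]
    rw [shaAn_def, leadingLCoeff_eq_of_analyticRank_eq_zero W hr, W.regulator_eq_one_of_rank_zero hmw0, hLq]
    push_cast
    field_simp
  · have ht : (W.torsionOrder : ℚ) ≠ 0 := by exact_mod_cast ht0.ne'
    have hcq : (W.tamagawaProduct : ℚ) ≠ 0 := by exact_mod_cast hc0.ne'
    have hsha : padicValNat 3 (Nat.card (AddCommGroup.primaryComponent W.sha 3)) = padicValNat 3 W.shaOrder := by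
      unfold WeierstrassCurve.shaOrder
      exact padicValNat_card_addPrimaryComponent 3
    have htv : padicValNat 3 W.torsionOrder = 0 := padicValNat.eq_zero_of_not_dvd htors
    have hv : padicValRat 3 (q₀ * (W.torsionOrder : ℚ) ^ 2 / (W.tamagawaProduct : ℚ)) =
        padicValRat 3 q₀ + 2 * (padicValNat 3 W.torsionOrder : ℤ) - (padicValNat 3 W.tamagawaProduct : ℤ) := by
      rw [padicValRat.div (mul_ne_zero hq₀0 (pow_ne_zero 2 ht)) hcq, padicValRat.mul hq₀0 (pow_ne_zero 2 ht), pow_two,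
        padicValRat.mul ht ht, padicValRat.of_nat, padicValRat.of_nat]
      ring
    rw [hv, ← hsha, htv, Nat.cast_zero, mul_zero, add_zero]
    linarith

/-- **CLASS TRANSPORT (Cassels; memo §2.2 "R₀•(E•) ⟹ MissingUpperBoundAt W′ 3 for EVERY member W′").**  If `E•` is a torsion-free
reducible O6 member of analytic rank `0` and `W′` is `ℚ`-isogenous to it, then `MissingUpperBoundAt W′ 3`: the upper half at `E•`
(previous theorem) transported by `Additive.TwistComparison.missingUpperBoundAt_of_isIsogenous` — `ord₃ #Ш − ord₃ #Ш_an` is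
class-constant granted the named fact `WeierstrassCurve.bsdRHS_eq_of_isIsogenous` (`hCassels`), GZK and modularity.  That every
X3 class at `3` HAS such a member `E•` (the `3`-isogeny walk; Mazur–Kenku; 9 476/9 476 in the data) is NOT typed — the member is
displayed. [cite: Cassels1965ArithmeticVIII] [cite: MilneADT2006, Thm. I.7.3 and Remark I.7.4] [cite: Miller2011LMS, §1 and Def. 1.1] -/
theorem X3WildRankZero.missingUpperBoundAt_of_isIsogenous_torsionFree (h : X3WildTorsionFreeKatoBoundThree)
    (hCassels : bsdRHS_eq_of_isIsogenous) (hGZK : rank_eq_analyticRank_of_analyticRank_le_one)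
    (hmod : hasEntireLFunction_rat) (E W' : WeierstrassCurve ℚ) [E.IsElliptic] [E.IsGloballyMinimal]
    [W'.IsElliptic] [W'.IsGloballyMinimal] (hiso : IsIsogenous E W')
    (hO : ClassO6 E 3) (hred : ¬ E.HasIrreducibleModPGaloisRep 3) (htors : ¬ (3 ∣ E.torsionOrder))
    (hr : E.analyticRank = 0) : MissingUpperBoundAt W' 3 :=
  TwistComparison.missingUpperBoundAt_of_isIsogenous E W' 3 hCassels hGZK hmod hiso (by rw [hr]; exact zero_le_one)
    (X3WildRankZero.missingUpperBoundAt_of_torsionFreeKatoBound h hGZK hmod E hO hred htors hr)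

end Assembly

end Summit.BirchSwinnertonDyer.Rank1Residual.O6

end
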